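import Literature.NumberTheory.Automorphic.GodementJacquetBoundaryValues
import Literature.NumberTheory.Automorphic.SelfdualGL3AdjointLiftProofs
import Literature.NumberTheory.Automorphic.PairLFunctionPolesRepDataRankTwo
import Literature.NumberTheory.Automorphic.BockleHuiIrreducibleGL3AnalyticProofs
import Literature.NumberTheory.Automorphic.AutomorphicRepCentralCharacter
import Literature.NumberTheory.Automorphic.LanglandsTetrahedral
import Literature.NumberTheory.Automorphic.GelbartJacquetSymmSquare
import HarnessLib

/-!
# The dihedral case of the crux `RegularTwistCM` is vacuous
(crux `IrreducibilityBySelfDuality.RegularTwistCM`, item stmt-Langlands-14069, line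
`petersson-hermitian-purity`, stub `stub_dihedralVacuity`)

Let `σ₀` be a cuspidal automorphic representation of `GL₂(𝔸_K)` (Borel–Jacquet datum) which is, for a
quadratic extension `L/K`, an almost-everywhere self-twist by `ε_{L/K}` (`IsQuadraticSelfTwistAE`, the
unramified shadow of "`σ₀` is monomial").  Then there is NO cuspidal `π` on `GL₃(𝔸_K)` and `ν` on
`GL₁(𝔸_K)` with `t_{π,v} = d_v · Ad(t_{σ₀,v})`, `{d_v} = t_{ν,v}`, at almost every `v`
(`stub_dihedralVacuity`).  In print this is Gelbart–Jacquet 1978, (3.7) and Remark (9.9) (the lift of a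
monomial `σ₀` is automorphic but not cuspidal) with Jacquet–Shalika 1981 II, Thm. 4.4; here it is proved
by the Rankin–Selberg argument of Ramakrishnan (2014, proof of Thm. A: `Ad(I(θ)) = ε ⊞ I(θ/θ^σ)`), whose
bookkeeping is that of `Ramakrishnan2014_selfdualGL3_adjointLift.not_isQuadraticSelfTwistAE_of_JS`
(`SelfdualGL3AdjointLiftProofs`), with ALL analytic inputs theorems of the tree:

* `dihedral_core` — `adjoint_dihedral_core` with its Jacquet–Shalika hypotheses discharged: (2.1) by
  `JacquetShalika1981_multipliable_partialPairL_repData_holds`, (2.3) on `GL₂` by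
  `JacquetShalika1981_partialPairL_pole_repData_rank_two`, and the two finite boundary values at `s = 1`
  by `GodementJacquetBoundaryValues` (`exists_tendsto_partialStandardL_bj`: Godement–Jacquet for `GL₃`;
  `exists_tendsto_partialPairL_singleton_one`: Hecke–Landau for `ε`):
  `(s - 1) L^S(s, P₁ × P₁^∨) = (s - 1) L^S(s, A ⊗ ε) L^S(s, ε) → 0` against the Rankin–Selberg pole;
* `not_isQuadraticSelfTwistAE_of_adjoint_twist` — a cuspidal `Π` on `GL₃` with
  `t_Π = ν(ϖ_v) Ad(t_π)` a.e. forces `π` non-dihedral (central character `Ω` of `π` at Satake level from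
  `exists_heckeCharacter_prod_satake_bj`, `ε = ε_{L/K}` as a Hecke character `≠ 1`, `A = Π ⊗ ν⁻¹ ε`,
  unitary normalisation `P₁ = π ⊗ ν₀`, `P₂ = π ⊗ (ν₀ Ω)⁻¹`, factor identity
  `satakePairPolynomial_twists_eq_of_selfTwist`);
* `stub_dihedralVacuity` — the registered stub: `ν` is read as the Hecke character `Ω_ν` with
  `Ω_ν(ϖ_v) = d_v` a.e., and `adParams β` is literally the crux's `((β ×ˢ β).map (r ↦ r.1 r.2⁻¹)).erase 1`.

References: S. Gelbart, H. Jacquet, Ann. Sci. ÉNS 11 (1978), (3.7), Thm. (9.3), Remark (9.9)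
[GelbartJacquet1978]; H. Jacquet, J. Shalika, Amer. J. Math. 103 (1981) II, Thm. 4.4
[JacquetShalikaAJM1981II]; D. Ramakrishnan, *An exercise concerning the selfdual cusp forms on GL(3)*
(2014), proof of Thm. A [Ramakrishnan2014]; J. Arthur, L. Clozel (1989), Ch. 3 §2 (2.1)–(2.3)
[ArthurClozelAMS120].
-/

-- `Summit.Langlands.Langlands.…` (problem = summit name, D-0017 layout) trips `dupNamespace` on every declaration;
-- the lakefile sets the same option for the `Summits` library.
set_option linter.dupNamespace false

noncomputable section

open Filter Topology IsDedekindDomain NumberField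
open scoped Classical
open Literature.NumberTheory Literature.NumberTheory.Automorphic
open Literature.NumberTheory.GaloisRepresentations (HeckeCharacter ideleGroup localUnits)

namespace Summit.Langlands.Langlands.Theorems.RegularTwistCM

section Dihedral

variable {F : Type} [Field F] [NumberField F]

/-- **Analytic core: a dihedral `π` has no cuspidal `ν Ad(π)`, UNCONDITIONALLY in the tree.** This is
`adjoint_dihedral_core` (`SelfdualGL3AdjointLiftProofs`) with its three Jacquet–Shalika hypotheses
discharged: (2.1) is the theorem `JacquetShalika1981_multipliable_partialPairL_repData_holds`; (2.3) on
`GL₂` is `JacquetShalika1981_partialPairL_pole_repData_rank_two` (the Rankin–Selberg pole from the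
Kirillov model, proved in the tree); and of (2.2) only FINITE boundary values at `s = 1` are used — for
`GL₃ × GL₁` the Godement–Jacquet boundary value `exists_tendsto_partialStandardL_bj`, for `GL₁ × GL₁`
Hecke–Landau `exists_tendsto_partialPairL_singleton_one`. Data: cuspidal `τ₁, τ_ε` on `GL(1)` with
families `{1}`, `{ε(ϖ_w)}` (`ε ≠ 1` of finite order, unramified with `ε(ϖ_w) = ±1` off `T`), `A` on
`GL(3)` and `P₁, P₂` on `GL(2)` with unitary families `Af`, `p₁`, `p₂ = p₁⁻¹` off the finite `T`, and
`det(1 - p₁ ⊗ p₂ T) = det(1 - Af ⊗ {1} T) det(1 - {ε} ⊗ {1} T)`: then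
`(s - 1) L^S(s, P₁ × P₂) = (s - 1) L^S(s, A) L^S(s, ε) → 0`, against the pole of (2.3).
[cite: Ramakrishnan2014, proof of Theorem A] [cite: GelbartJacquet1978, Thm. (9.3) and Remark (9.9)]
[cite: ArthurClozelAMS120, Ch. 3 §2 (2.1)–(2.3)] -/
theorem dihedral_core {h1 : isCompact_glFiniteIntegralLevel 1 F} {h2 : isCompact_glFiniteIntegralLevel 2 F}
    {h3 : isCompact_glFiniteIntegralLevel 3 F}
    (τ1 τε : CuspidalAutomorphicRepData 1 F h1) (A : CuspidalAutomorphicRepData 3 F h3)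
    (P₁ P₂ : CuspidalAutomorphicRepData 2 F h2) {ε : HeckeCharacter F} (hfin : ε.IsFiniteOrder)
    (hε1 : ε ≠ 1) (Af p₁ p₂ : SatakeFamily F) {T : Set (HeightOneSpectrum (𝓞 F))} (hT : T.Finite)
    (hτ1 : ∀ w ∉ T, τ1.1.HasSatakeParamAt w {1})
    (hτε : ∀ w ∉ T, τε.1.HasSatakeParamAt w {ε.valueAtUniformizer w})
    (hur : ∀ w ∉ T, ε.IsUnramifiedAt w)
    (hsgn : ∀ w ∉ T, ε.valueAtUniformizer w = 1 ∨ ε.valueAtUniformizer w = -1)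
    (hA : ∀ w ∉ T, A.1.HasSatakeParamAt w (Af w))
    (hP₁ : ∀ w ∉ T, P₁.1.HasSatakeParamAt w (p₁ w)) (hP₂ : ∀ w ∉ T, P₂.1.HasSatakeParamAt w (p₂ w))
    (huA : ∀ w ∉ T, ‖(Af w).prod‖ = 1)
    (hu₁ : ∀ w ∉ T, ‖(p₁ w).prod‖ = 1) (hu₂ : ∀ w ∉ T, ‖(p₂ w).prod‖ = 1)
    (hX : ∀ w ∉ T, (p₂ w).map (·⁻¹) = p₁ w)
    (hId : ∀ w ∉ T, satakePairPolynomial (p₁ w) (p₂ w) =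
      satakePairPolynomial (Af w) {1} * satakePairPolynomial {ε.valueAtUniformizer w} {1}) :
    False := by
  -- the exceptional sets of (2.1), of the two boundary values and of (2.3)
  obtain ⟨S₁, hS₁, hJ1a⟩ :=
    JacquetShalika1981_multipliable_partialPairL_repData_holds 3 1 F h3 h1 (by norm_num) one_pos A τ1
  obtain ⟨S₂, hS₂, hJ1b⟩ :=
    JacquetShalika1981_multipliable_partialPairL_repData_holds 1 1 F h1 h1 one_pos one_pos τε τ1
  obtain ⟨S₃, hS₃, hJ2a⟩ := exists_tendsto_partialStandardL_bj (by norm_num) h3 A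
  obtain ⟨S₅, hS₅, hJ3a⟩ := JacquetShalika1981_partialPairL_pole_repData_rank_two h2 P₁ P₂
  set S : Set (HeightOneSpectrum (𝓞 F)) := T ∪ S₁ ∪ S₂ ∪ S₃ ∪ S₅ with hS_def
  have hS : S.Finite := (((hT.union hS₁).union hS₂).union hS₃).union hS₅
  have hTS : ∀ w ∉ S, w ∉ T := fun w hw hwT => hw (by simp [hS_def, hwT])
  have sub₁ : S₁ ⊆ S := fun x hx => by simp [hS_def, hx]
  have sub₂ : S₂ ⊆ S := fun x hx => by simp [hS_def, hx]
  have sub₃ : S₃ ⊆ S := fun x hx => by simp [hS_def, hx]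
  have sub₅ : S₅ ⊆ S := fun x hx => by simp [hS_def, hx]
  -- the hypotheses off `S`
  have hτ1S : ∀ w ∉ S, τ1.1.HasSatakeParamAt w ((fun _ : HeightOneSpectrum (𝓞 F) => ({1} : Multiset ℂ)) w) :=
    fun w hw => hτ1 w (hTS w hw)
  have hτεS : ∀ w ∉ S, τε.1.HasSatakeParamAt w
      ((fun w : HeightOneSpectrum (𝓞 F) => ({ε.valueAtUniformizer w} : Multiset ℂ)) w) :=
    fun w hw => hτε w (hTS w hw)
  have hAS : ∀ w ∉ S, A.1.HasSatakeParamAt w (Af w) := fun w hw => hA w (hTS w hw)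
  have hP₁S : ∀ w ∉ S, P₁.1.HasSatakeParamAt w (p₁ w) := fun w hw => hP₁ w (hTS w hw)
  have hP₂S : ∀ w ∉ S, P₂.1.HasSatakeParamAt w (p₂ w) := fun w hw => hP₂ w (hTS w hw)
  have huone : ∀ w ∉ S, ‖((fun _ : HeightOneSpectrum (𝓞 F) => ({1} : Multiset ℂ)) w).prod‖ = 1 :=
    fun w _ => by simp
  have hueps : ∀ w ∉ S,
      ‖((fun w : HeightOneSpectrum (𝓞 F) => ({ε.valueAtUniformizer w} : Multiset ℂ)) w).prod‖ = 1 := by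
    intro w hw
    simp only [Multiset.prod_singleton]
    rcases hsgn w (hTS w hw) with h | h <;> simp [h]
  have huAS : ∀ w ∉ S, ‖(Af w).prod‖ = 1 := fun w hw => huA w (hTS w hw)
  have hu₁S : ∀ w ∉ S, ‖(p₁ w).prod‖ = 1 := fun w hw => hu₁ w (hTS w hw)
  have hu₂S : ∀ w ∉ S, ‖(p₂ w).prod‖ = 1 := fun w hw => hu₂ w (hTS w hw)
  -- the `X`-condition of (2.3) for `(P₁, P₂)` at `s₀ = 1`
  have hXP : ∀ᶠ w : HeightOneSpectrum (𝓞 F) in cofinite,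
      (p₁ w).map ((((w.residueCard : ℂ)) ^ ((1 : ℂ) - 1)) * ·) = (p₂ w).map (·⁻¹) := by
    filter_upwards [hT.eventually_cofinite_notMem] with w hw
    rw [sub_self, Complex.cpow_zero, hX w hw]
    simp
  -- (2.1): multipliability of the two Euler products on the right
  have mA1 : ∀ s : ℂ, 1 < s.re → Multipliable fun v : {v : HeightOneSpectrum (𝓞 F) // v ∉ S} =>
      ((satakePairPolynomial (Af v.1) {1}).eval ((v.1.residueCard : ℂ) ^ (-s)))⁻¹ :=
    fun s hs => hJ1a hS sub₁ hAS hτ1S huAS huone hs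
  have mε1 : ∀ s : ℂ, 1 < s.re → Multipliable fun v : {v : HeightOneSpectrum (𝓞 F) // v ∉ S} =>
      ((satakePairPolynomial {ε.valueAtUniformizer v.1} {1}).eval ((v.1.residueCard : ℂ) ^ (-s)))⁻¹ :=
    fun s hs => hJ1b hS sub₂ hτεS hτ1S hueps huone hs
  -- the two finite boundary values at `s = 1`
  obtain ⟨c₁, hF₁⟩ := hJ2a hS sub₃ hAS huAS Complex.one_re
  rw [partialStandardL_eq_partialPairL_one] at hF₁
  obtain ⟨c₂, hF₂⟩ := exists_tendsto_partialPairL_singleton_one ε hfin hε1 hS (fun w hw => hur w (hTS w hw))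
  -- (2.3) for `(P₁, P₂)`: a simple pole
  obtain ⟨c₃, hc₃, hG⟩ := hJ3a hS sub₅ hP₁S hP₂S hu₁S hu₂S Complex.one_re hXP
  -- the factorisation on `Re s > 1`
  have hL : ∀ᶠ s in 𝓝[{s : ℂ | 1 < s.re}] (1 : ℂ),
      partialPairL S p₁ p₂ s = partialPairL S Af (fun _ => {1}) s *
        partialPairL S (fun w => {ε.valueAtUniformizer w}) (fun _ => {1}) s := by
    refine eventually_nhdsWithin_of_forall fun s hs => ?_
    unfold partialPairL
    have hfun : (fun v : {v : HeightOneSpectrum (𝓞 F) // v ∉ S} =>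
        ((satakePairPolynomial (p₁ v.1) (p₂ v.1)).eval ((v.1.residueCard : ℂ) ^ (-s)))⁻¹) =
        fun v : {v : HeightOneSpectrum (𝓞 F) // v ∉ S} =>
          ((satakePairPolynomial (Af v.1) {1}).eval ((v.1.residueCard : ℂ) ^ (-s)))⁻¹ *
            ((satakePairPolynomial {ε.valueAtUniformizer v.1} {1}).eval ((v.1.residueCard : ℂ) ^ (-s)))⁻¹ := by
      funext v
      rw [hId v.1 (hTS v.1 v.2), Polynomial.eval_mul, mul_inv]
    rw [hfun, (mA1 s (by exact hs)).tprod_mul (mε1 s (by exact hs))]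
  -- `(s - 1) L^S(s, P₁ × P₂) → 0`, against the simple pole
  have h0 : Tendsto (fun s => (s - 1) * partialPairL S p₁ p₂ s) (𝓝[{s : ℂ | 1 < s.re}] 1)
      (𝓝 (0 * c₁ * c₂)) := by
    refine ((tendsto_sub_one_nhdsWithin_one_lt_re.mul hF₁).mul hF₂).congr' ?_
    filter_upwards [hL] with s hs
    simp only [hs, mul_assoc]
  rw [zero_mul, zero_mul] at h0
  exact hc₃ (tendsto_nhds_unique hG h0)

/-- **A dihedral `π` on `GL₂` has no cuspidal `ν Ad(π)` on `GL₃` — unconditionally** (Gelbart–Jacquet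
1978, Thm. (9.3) with Remark (9.9): the lift is cuspidal "unless `π` is monomial"; Ramakrishnan 2014,
proof of Theorem A: `Ad(I(θ)) = ε ⊞ I(θ/θ^σ)` is not cuspidal). Borel–Jacquet data, Satake level: if
`Π` cuspidal on `GL₃(𝔸_F)` has `t_{Π,v} = ν(ϖ_v) Ad(t_{π,v})` a.e. for a Hecke character `ν`, then
`π` is for no quadratic `K/F` an a.e. self-twist by `ε_{K/F}` (`IsQuadraticSelfTwistAE`). The proof is
that of `Ramakrishnan2014_selfdualGL3_adjointLift.not_isQuadraticSelfTwistAE_of_JS` verbatim (central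
character `Ω` of `π` from `exists_heckeCharacter_prod_satake_bj`; `ε = ε_{K/F}` a Hecke character
`≠ 1`; `A = Π ⊗ ν⁻¹ ε`; unitary normalisation `P₁ = π ⊗ ν₀`, `P₂ = π ⊗ (ν₀ Ω)⁻¹ ≃ P₁^∨`; the factor
identity `satakePairPolynomial_twists_eq_of_selfTwist`), closed by the unconditional `dihedral_core`.
[cite: GelbartJacquet1978, Thm. (9.3) and Remark (9.9)] [cite: Ramakrishnan2014, proof of Theorem A] -/
theorem not_isQuadraticSelfTwistAE_of_adjoint_twist
    {hF2 : isCompact_glFiniteIntegralLevel 2 F} {hF3 : isCompact_glFiniteIntegralLevel 3 F}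
    (π : CuspidalAutomorphicRepData 2 F hF2) (P : CuspidalAutomorphicRepData 3 F hF3) (ν : HeckeCharacter F)
    (hsat : ∀ᶠ v : HeightOneSpectrum (𝓞 F) in Filter.cofinite, ∀ β : Multiset ℂ,
      π.1.HasSatakeParamAt v β →
        P.1.HasSatakeParamAt v ((adParams β).map fun c => ν.valueAtUniformizer v * c))
    (K : Type) [Field K] [NumberField K] [Algebra F K] (hK : Module.finrank F K = 2) :
    ¬ IsQuadraticSelfTwistAE K π.1 := by
  intro hdih
  obtain ⟨Ω, hΩ⟩ := π.exists_heckeCharacter_prod_satake_bj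
  have h1 : isCompact_glFiniteIntegralLevel 1 F := isCompact_glFiniteIntegralLevel_holds 1 F
  -- `ε = ε_{K/F}` as a Hecke character `≠ 1` of finite order
  obtain ⟨ε, hε1, hfin, hε⟩ := exists_ne_one_heckeCharacter_quadraticSign (F := F) (E := K) hK
  -- `A = Π ⊗ ν⁻¹ ε`, with `t_A = ε Ad(t_π)`
  haveI : NeZero (3 : ℕ) := ⟨by norm_num⟩
  obtain ⟨A, hA⟩ := CuspidalAutomorphicRepData.exists_twist_hecke_hasSatakeParamAt (ν⁻¹ * ε) P
  -- `1` and `ε` as cuspidal data on `GL(1)`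
  obtain ⟨τ1, hτ1⟩ := exists_cuspidal_glOne_hasSatakeParamAt_valueAtUniformizer h1 (1 : HeckeCharacter F)
  obtain ⟨τε, hτε⟩ := exists_cuspidal_glOne_hasSatakeParamAt_valueAtUniformizer h1 ε
  -- the unitary normalisation `P₁ = π ⊗ ν₀`, `P₂ = π ⊗ (ν₀ Ω)⁻¹`
  obtain ⟨σ, hσ⟩ := Ω.exists_norm_apply_eq_ideleNorm_rpow
  obtain ⟨ν₀, hν₀⟩ := exists_heckeCharacter_ideleNorm_cpow F ((-(σ / 2) : ℝ) : ℂ)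
  have hνΩ : ∀ x : ideleGroup F, ‖((ν₀ x : ℂˣ) : ℂ)‖ ^ 2 * ‖((Ω x : ℂˣ) : ℂ)‖ = 1 := by
    intro x
    have hN : (0 : ℝ) < GaloisRepresentations.ideleNorm x := by
      rw [← coe_ideleNorm]
      exact NNReal.coe_pos.2 (pos_iff_ne_zero.2 (ideleNorm_ne_zero _))
    rw [hν₀ x, Complex.norm_cpow_eq_rpow_re_of_pos hN, Complex.ofReal_re, hσ x,
      ← Real.rpow_natCast, ← Real.rpow_mul hN.le, ← Real.rpow_add hN]
    have e : -(σ / 2) * ((2 : ℕ) : ℝ) + σ = 0 := by push_cast; ring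
    rw [e, Real.rpow_zero]
  haveI : NeZero (2 : ℕ) := ⟨by norm_num⟩
  obtain ⟨P₁, hP₁⟩ := CuspidalAutomorphicRepData.exists_twist_hecke_hasSatakeParamAt ν₀ π
  obtain ⟨P₂, hP₂⟩ := CuspidalAutomorphicRepData.exists_twist_hecke_hasSatakeParamAt (ν₀ * Ω)⁻¹ π
  -- a Satake family of `π`
  obtain ⟨tf, etf⟩ : ∃ f : SatakeFamily F, ∀ᶠ w : HeightOneSpectrum (𝓞 F) in cofinite,
      π.1.HasSatakeParamAt w (f w) :=
    ⟨fun w => if h : π.1.IsUnramifiedAt w then h.choose else 0, by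
      filter_upwards [π.1.hasSatakeParamAt_cofinite_holds] with w hw
      rw [dif_pos hw]
      exact hw.choose_spec⟩
  -- the good places
  have hgood : ∀ᶠ w : HeightOneSpectrum (𝓞 F) in cofinite,
      π.1.HasSatakeParamAt w (tf w) ∧ (tf w).map (ε.valueAtUniformizer w * ·) = tf w ∧
      (ε.valueAtUniformizer w = 1 ∨ ε.valueAtUniformizer w = -1) ∧ ε.IsUnramifiedAt w ∧
      Ω.valueAtUniformizer w = (tf w).prod ∧
      A.1.HasSatakeParamAt w ((adParams (tf w)).map (ε.valueAtUniformizer w * ·)) ∧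
      τ1.1.HasSatakeParamAt w {1} ∧
      τε.1.HasSatakeParamAt w {ε.valueAtUniformizer w} ∧
      P₁.1.HasSatakeParamAt w ((tf w).map (ν₀.valueAtUniformizer w * ·)) ∧
      P₂.1.HasSatakeParamAt w ((tf w).map ((ν₀ * Ω)⁻¹.valueAtUniformizer w * ·)) := by
    have hdih' : ∀ᶠ w : HeightOneSpectrum (𝓞 F) in cofinite, ∀ α : Multiset ℂ,
        π.1.HasSatakeParamAt w α → α.map (quadraticSign K w * ·) = α := hdih
    filter_upwards [etf, hdih', hε, hΩ, hsat, hA, hτ1, hτε, hP₁, hP₂]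
      with w h1w hdw hεw hΩw hsw hAw hτ1w hτεw hP₁w hP₂w
    refine ⟨h1w, ?_, ?_, hεw.1, hΩw _ h1w, ?_, ?_, hτεw, hP₁w _ h1w, hP₂w _ h1w⟩
    · rw [hεw.2]; exact hdw _ h1w
    · rw [hεw.2]; exact quadraticSign_eq_one_or (E := K) w
    · have h := hAw _ (hsw _ h1w)
      rw [Multiset.map_map] at h
      have e : ((fun x => (ν⁻¹ * ε).valueAtUniformizer w * x) ∘ fun c => ν.valueAtUniformizer w * c) =
          fun x => ε.valueAtUniformizer w * x := by
        funext x
        simp only [Function.comp_apply]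
        rw [GaloisRepresentations.HeckeCharacter.valueAtUniformizer_mul, heckeCharacter_valueAtUniformizer_inv,
          mul_assoc, mul_left_comm (ε.valueAtUniformizer w), ← mul_assoc,
          inv_mul_cancel₀ (heckeCharacter_valueAtUniformizer_ne_zero ν w), one_mul]
      rwa [e] at h
    · simpa only [Ramakrishnan2014_selfdualGL3_adjointLift.one_valueAtUniformizer] using hτ1w
  obtain ⟨T, hT, hgoodT⟩ : ∃ T : Set (HeightOneSpectrum (𝓞 F)), T.Finite ∧ ∀ w ∉ T,
      π.1.HasSatakeParamAt w (tf w) ∧ (tf w).map (ε.valueAtUniformizer w * ·) = tf w ∧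
      (ε.valueAtUniformizer w = 1 ∨ ε.valueAtUniformizer w = -1) ∧ ε.IsUnramifiedAt w ∧
      Ω.valueAtUniformizer w = (tf w).prod ∧
      A.1.HasSatakeParamAt w ((adParams (tf w)).map (ε.valueAtUniformizer w * ·)) ∧
      τ1.1.HasSatakeParamAt w {1} ∧
      τε.1.HasSatakeParamAt w {ε.valueAtUniformizer w} ∧
      P₁.1.HasSatakeParamAt w ((tf w).map (ν₀.valueAtUniformizer w * ·)) ∧
      P₂.1.HasSatakeParamAt w ((tf w).map ((ν₀ * Ω)⁻¹.valueAtUniformizer w * ·)) :=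
    ⟨_, Filter.eventually_cofinite.1 hgood, fun w hw => not_not.1 hw⟩
  -- pointwise consequences at a good place
  have card2 : ∀ w ∉ T, Multiset.card (tf w) = 2 := fun w hw => (hgoodT w hw).1.card_eq
  have nz : ∀ w ∉ T, (0 : ℂ) ∉ tf w := fun w hw => (hgoodT w hw).1.zero_not_mem
  have hlam : ∀ w, (ν₀ * Ω)⁻¹.valueAtUniformizer w =
      (ν₀.valueAtUniformizer w)⁻¹ * (Ω.valueAtUniformizer w)⁻¹ := fun w => by
    rw [heckeCharacter_valueAtUniformizer_inv,
      GaloisRepresentations.HeckeCharacter.valueAtUniformizer_mul, mul_inv]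
  have hX : ∀ w ∉ T, ((tf w).map ((ν₀ * Ω)⁻¹.valueAtUniformizer w * ·)).map (·⁻¹) =
      (tf w).map (ν₀.valueAtUniformizer w * ·) := by
    intro w hw
    obtain ⟨-, -, -, -, hΩw, -⟩ := hgoodT w hw
    have hp0 : (tf w).prod ≠ 0 := Multiset.prod_ne_zero (nz w hw)
    rw [Multiset.map_map]
    calc (tf w).map ((fun x => x⁻¹) ∘ ((ν₀ * Ω)⁻¹.valueAtUniformizer w * ·))
        = ((tf w).map (fun x => x⁻¹)).map ((ν₀.valueAtUniformizer w * Ω.valueAtUniformizer w) * ·) := by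
            rw [Multiset.map_map]
            refine Multiset.map_congr rfl fun x _ => ?_
            simp only [Function.comp_apply]
            rw [hlam, mul_inv, mul_inv, inv_inv, inv_inv]
      _ = (tf w).map (ν₀.valueAtUniformizer w * ·) := by
            rw [map_inv_eq_map_mul_of_card_eq_two (card2 w hw) (nz w hw), Multiset.map_map, hΩw]
            refine Multiset.map_congr rfl fun x _ => ?_
            simp only [Function.comp_apply]
            rw [← mul_assoc, mul_assoc (ν₀.valueAtUniformizer w), mul_inv_cancel₀ hp0, mul_one]
  have hu₁ : ∀ w ∉ T, ‖((tf w).map (ν₀.valueAtUniformizer w * ·)).prod‖ = 1 := by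
    intro w hw
    obtain ⟨-, -, -, -, hΩw, -⟩ := hgoodT w hw
    rw [prod_map_const_mul_eq, card2 w hw, ← hΩw, norm_mul, norm_pow]
    exact hνΩ (localUnits w (GaloisRepresentations.HeckeCharacter.uniformizer F w))
  have hu₂ : ∀ w ∉ T, ‖((tf w).map ((ν₀ * Ω)⁻¹.valueAtUniformizer w * ·)).prod‖ = 1 := by
    intro w hw
    have e : (tf w).map ((ν₀ * Ω)⁻¹.valueAtUniformizer w * ·) =
        ((tf w).map (ν₀.valueAtUniformizer w * ·)).map (·⁻¹) := by
      rw [← hX w hw, Multiset.map_map]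
      simp
    rw [e, Multiset.prod_map_inv, Multiset.map_id', norm_inv, hu₁ w hw, inv_one]
  have huA : ∀ w ∉ T, ‖((adParams (tf w)).map (ε.valueAtUniformizer w * ·)).prod‖ = 1 := by
    intro w hw
    rw [prod_map_const_mul_eq, prod_adParams_of_card_eq_two (card2 w hw) (nz w hw), mul_one, norm_pow]
    rcases (hgoodT w hw).2.2.1 with h | h <;> simp [h]
  have hId : ∀ w ∉ T,
      satakePairPolynomial ((tf w).map (ν₀.valueAtUniformizer w * ·))
          ((tf w).map ((ν₀ * Ω)⁻¹.valueAtUniformizer w * ·)) =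
        satakePairPolynomial ((adParams (tf w)).map (ε.valueAtUniformizer w * ·)) {1} *
          satakePairPolynomial {ε.valueAtUniformizer w} {1} := by
    intro w hw
    obtain ⟨-, hew, -, -, hΩw, -⟩ := hgoodT w hw
    rw [satakePairPolynomial_map_mul_singleton_one]
    refine satakePairPolynomial_twists_eq_of_selfTwist (card2 w hw) (nz w hw) hew ?_
    rw [hlam, ← mul_assoc, mul_inv_cancel₀ (heckeCharacter_valueAtUniformizer_ne_zero ν₀ w), one_mul,
      hΩw]
  exact dihedral_core τ1 τε A P₁ P₂ hfin hε1
    (fun w => (adParams (tf w)).map (ε.valueAtUniformizer w * ·))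
    (fun w => (tf w).map (ν₀.valueAtUniformizer w * ·))
    (fun w => (tf w).map ((ν₀ * Ω)⁻¹.valueAtUniformizer w * ·)) hT
    (fun w hw => (hgoodT w hw).2.2.2.2.2.2.1) (fun w hw => (hgoodT w hw).2.2.2.2.2.2.2.1)
    (fun w hw => (hgoodT w hw).2.2.2.1) (fun w hw => (hgoodT w hw).2.2.1)
    (fun w hw => (hgoodT w hw).2.2.2.2.2.1) (fun w hw => (hgoodT w hw).2.2.2.2.2.2.2.2.1)
    (fun w hw => (hgoodT w hw).2.2.2.2.2.2.2.2.2) huA hu₁ hu₂ hX hId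

/-- **stub_dihedralVacuity** of the line `petersson-hermitian-purity` of the crux
`IrreducibilityBySelfDuality.RegularTwistCM` (stmt-Langlands-14069): **the dihedral case of the crux is
VACUOUS.** For cuspidal `π` on `GL₃(𝔸_K)`, `σ₀` on `GL₂(𝔸_K)` and `ν` on `GL₁(𝔸_K)` (Borel–Jacquet
data over any number field `K`) and a quadratic `L/K` for which `σ₀` is an a.e. self-twist by
`ε_{L/K}` (`IsQuadraticSelfTwistAE`), the crux's a.e. identity `t_{π,v} = d_v · Ad(t_{σ₀,v})`,
`{d_v} = t_{ν,v}` (here `Ad(β) = ((β ×ˢ β).map (r ↦ r.1 r.2⁻¹)).erase 1 = adParams β`), FAILS: read `ν`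
as the Hecke character `Ω_ν` with `Ω_ν(ϖ_v) = d_v` a.e. (`exists_heckeCharacter_prod_satake_bj` on
`GL₁`) and `π` unramified a.e. (`hasSatakeParamAt_cofinite_holds`), so that `t_π = Ω_ν Ad(t_{σ₀})`
a.e., and apply `not_isQuadraticSelfTwistAE_of_adjoint_twist`. In print: Gelbart–Jacquet 1978, (3.7)
and Remark (9.9) (the lift of a monomial `σ₀` is not cuspidal) with Jacquet–Shalika 1981 II, Thm. 4.4;
here the Rankin–Selberg form of Ramakrishnan 2014 (proof of Thm. A), all analytic inputs being theorems
of the tree (Godement–Jacquet for the zeta integral, the `GL₂ × GL₂` pole, Hecke–Landau).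
[cite: GelbartJacquet1978, (3.7), Thm. (9.3) and Remark (9.9)] [cite: JacquetShalikaAJM1981II, Thm. 4.4] -/
theorem stub_dihedralVacuity :
    ∀ (K : Type) [Field K] [NumberField K]
      (h1 : isCompact_glFiniteIntegralLevel 1 K) (hcpt₂ : isCompact_glFiniteIntegralLevel 2 K)
      (hcpt : isCompact_glFiniteIntegralLevel 3 K)
      (π : CuspidalAutomorphicRepData 3 K hcpt) (σ₀ : CuspidalAutomorphicRepData 2 K hcpt₂)
      (ν : CuspidalAutomorphicRepData 1 K h1)
      (L : Type) [Field L] [NumberField L] [Algebra K L], Module.finrank K L = 2 →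
      IsQuadraticSelfTwistAE L σ₀.1 →
      ¬ (∀ᶠ v in cofinite, ∀ α β : Multiset ℂ, π.1.HasSatakeParamAt v α →
        σ₀.1.HasSatakeParamAt v β → ∃ d : ℂ, ν.1.HasSatakeParamAt v {d} ∧
          α = (((β ×ˢ β).map (fun r : ℂ × ℂ => r.1 * r.2⁻¹)).erase 1).map (fun e => d * e)) := by
  intro K _ _ h1 hcpt₂ hcpt π σ₀ ν L _ _ _ hL hdih H
  obtain ⟨Ων, hΩν⟩ := ν.exists_heckeCharacter_prod_satake_bj
  have hsat : ∀ᶠ v : HeightOneSpectrum (𝓞 K) in cofinite, ∀ β : Multiset ℂ,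
      σ₀.1.HasSatakeParamAt v β →
        π.1.HasSatakeParamAt v ((adParams β).map fun c => Ων.valueAtUniformizer v * c) := by
    filter_upwards [H, π.1.hasSatakeParamAt_cofinite_holds, hΩν] with v hH hπv hνv
    intro β hβ
    obtain ⟨α, hα⟩ := hπv
    obtain ⟨d, hd, hαeq⟩ := hH α β hα hβ
    have hdv : Ων.valueAtUniformizer v = d := by rw [hνv {d} hd, Multiset.prod_singleton]
    have had : adParams β = ((β ×ˢ β).map (fun r : ℂ × ℂ => r.1 * r.2⁻¹)).erase 1 := rfl
    rw [hdv, had, ← hαeq]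
    exact hα
  exact not_isQuadraticSelfTwistAE_of_adjoint_twist σ₀ π Ων hsat L hL hdih

end Dihedral

end Summit.Langlands.Langlands.Theorems.RegularTwistCM

end
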